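/- Copyright: the b2b-balaban cell (near-miss cell 7), T⁴-continuum fan-out; row NE7b ROUND-2 swarm, seat
t4-ne7b-formalise-leaf-06 (gen 8) (road W-RP, sub-row «W-LAB», file 11c: THE BOND READER IMPLIES THE PLAQUETTE READER —
one direction, tolerances `ε ↦ 4ε`; INTENT journal l.19807).  Released under the licence of the surrounding project. -/
import Summits.QuantumFields.BalabanUV.T4Continuum.Support.HistoryChessboardPlaquetteReader
import Summits.QuantumFields.BalabanUV.T4Continuum.Support.HistoryChessboardSmallFieldReader

/-!
# Road W-RP, sub-row «W-LAB», file 11c: file 10's BOND reader ⇒ file 11's PLAQUETTE reader (`ε ↦ 4ε`, same rate)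

Summits-side support leaf of the T⁴-continuum cell (rung (B)+1 on a FINITE torus only; NOT infinite volume, NOT the
mass gap, NOT the Clay statement; NOT a proof of the spine estimate NE7b).  Row NE7b, road **W-RP** (R-OWNER-23-2 ∕
R-OWNER-23-8), sub-row «W-LAB», file 11c: the ONE-DIRECTION junction between the two readers of this sub-row — file 10
(`HistoryChessboardSmallFieldReader`: `smallReader F {g | dist1 g < ε} m₁ K`, «every BOND variable of the cube's column is
`ε`-close to `1`») and file 11b (`HistoryChessboardPlaquetteReader`: `plaqReader F δ m₁ K`, «the tree's `PlaqSmallOn` at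
every level of the column»), over file 11a's `letters_mem_boxBonds` and W3o-3's `boxUniform`.  [folklore] bookkeeping
(the triangle inequality `GaugeGroup.dist1_mul_le` three times and `dist1_inv` twice along the four letters of `U(∂p)`
— whence the `4`, an elementary constant of the plaquette word, NOT a constant of print (c2∕c6)); no def, no
`structure`, no `[cite:]` tag, no `Prop`-valued FACT (c1), no exit ∕ socket ∕ `HistoryConstants` file touched (c3);
nothing of files 10 ∕ 11a ∕ 11b restated.

WHY.  Files 10 and 11b are two instantiations of the four-clause reader shape (files 6∕8); this file records, in the
kernel, how they compare: bond-small at `ε` ⇒ plaquette-small at `4ε` at every level, so the plaquette reader's BAD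
pattern «every cube bad» lies INSIDE the bond reader's, and the ONE inequality displayed by file 10
(`readerCellSide_dist1`'s `huniv`) implies the one displayed by file 11b at tolerance `4ε` with the SAME rate `r`.  The
converse fails (gauge freedom: small plaquettes do not bound bond variables), so of the two (U1)×(G2) displays the
plaquette reader's is the weaker hypothesis — and the one phrased in the tree's own small-field predicate.

WHAT.  `plaqSmallOn_box_of_bonds` (one level), `plaqUniform_of_boxUniform` (the tower:
`boxUniform P G {dist1 < ε} K M k ⊆ plaqUniform P G (fun _ => 4ε) K M k`), `plaqReader_eq_true_of_smallReader`,
`setOf_plaqReader_false_subset`, **`readerCellSide_plaqReader_of_bonds (hM) (hr) (huniv)`** (file 10's `huniv` at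
`ε` ⇒ file 11b's `ReaderCellSide` for `plaqReader F (fun _ => 4ε) m₁ K`; `D.AvgMeasurable` makes `gibbsTower` a
probability measure, for monotonicity of `μ.real`).

HONEST SCOPE (R-OWNER-23-8 wording for road W-RP).  A comparison of two of OUR readers; discharges nothing of (EXT) ∕
(U1) ∕ (G2) ∕ H3 ∕ (B) ∕ BetaPertH ∕ NE7c ∕ NE7; no headline touched; 0∕9 unchanged.  NE7b NOT proved; spine 0∕9.
HONEST DEPENDENCY (cell): continuum YM on T⁴ ⇐ BetaPertH ∧ nine spine estimates (0/9 proved); BetaPertH ⇐ (D1) ∧ (D4) ∧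
CAP+tail; G-an2-4 gates asym, D1 and NE2/3/4.  This file changes none of it.
-/

open Finset MeasureTheory Literature.Barriers.CriticalPhenomena.NonGibbs
open Literature.MathematicalPhysics.QuantumFieldTheory
open Literature.MathematicalPhysics.QuantumFieldTheory.Balaban1983to89
open Literature.MathematicalPhysics.QuantumFieldTheory.Balaban1983to89.Missing
open Literature.MathematicalPhysics.QuantumFieldTheory.Balaban1983to89.T4Continuum
open T4UndoubledRP
open Summit.QuantumFields.BalabanUV.T4Continuum HistoryRPHalfTorus HistoryRPTowerLaw HistoryRPTowerCuts
open HistoryRPTowerCells HistoryRPTowerTemplates HistoryRPTowerColumns HistoryRPTowerUniform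
open HistoryChessboardEventsSplit HistoryChessboardEventsTower HistoryChessboardEventsCubes
open HistoryChessboardEventsTemplates HistoryChessboardTowerRepr HistoryChessboardGibbsSide HistoryChessboardLabels
open HistoryChessboardLabelsReader HistoryChessboardLabelsGibbsReader HistoryChessboardLabelsPattern
open HistoryChessboardGibbsCells HistoryChessboardReaderCells HistoryChessboardGibbsCellsTemplates
open HistoryChessboardSmallFieldReader HistoryChessboardPlaquetteBox HistoryChessboardPlaquetteReader

namespace Summit.QuantumFields.BalabanUV.T4Continuum.HistoryChessboardPlaquetteReaderBonds

noncomputable section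

variable {P : Params} {G : Type*}

/-! ## §1 One level: `ε`-small box bonds ⇒ `PlaqSmallOn` at `4ε` on the box plaquettes -/

section OneLevel

/-- **`ε`-SMALL BONDS ⇒ `4ε`-SMALL PLAQUETTES ON THE BOX** (`dist1_mul_le` ×3, `dist1_inv` ×2): W3o-3's ∕ file 10's
bond template «every box bond has `dist1 (U b) < ε`» implies the tree's `PlaqSmallOn` on the box plaquettes at tolerance
`4ε` (the converse fails — gauge freedom). [folklore] -/
theorem plaqSmallOn_box_of_bonds [GaugeGroup G] {j s : ℕ} {ε : ℝ} {U : GaugeField P j G}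
    (h : ∀ b ∈ boxBonds P j s, dist1 (U b) < ε) : PlaqSmallOn (↑(boxPlaqs P j s)) (4 * ε) U := by
  intro p hp
  obtain ⟨h1, h2, h3, h4⟩ := letters_mem_boxBonds (Finset.mem_coe.1 hp)
  have d1 := h _ h1
  have d2 := h _ h2
  have d3 := h _ h3
  have d4 := h _ h4
  have key : ∀ g₁ g₂ g₃ g₄ : G, dist1 (g₁ * g₂ * g₃⁻¹ * g₄⁻¹) ≤ dist1 g₁ + dist1 g₂ + dist1 g₃ + dist1 g₄ := by
    intro g₁ g₂ g₃ g₄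
    have a1 := GaugeGroup.dist1_mul_le (g₁ * g₂ * g₃⁻¹) g₄⁻¹
    have a2 := GaugeGroup.dist1_mul_le (g₁ * g₂) g₃⁻¹
    have a3 := GaugeGroup.dist1_mul_le g₁ g₂
    rw [GaugeGroup.dist1_inv] at a1 a2
    linarith
  unfold GaugeField.plaqHol
  exact (key _ _ _ _).trans_lt (by linarith)

end OneLevel

/-! ## §2 The tower and the reader: file 10 at `ε` ⇒ file 11b at `4ε` -/

section Junction

variable [GaugeGroup G]

/-- **THE BOND TEMPLATE IMPLIES THE PLAQUETTE TEMPLATE** (every level; §1): W3o-3's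
`boxUniform` for the tolerance set `{g | dist1 g < ε}` lies inside `plaqUniform` at the constant tolerance `4ε`.
[folklore] -/
theorem plaqUniform_of_boxUniform (ε : ℝ) (K M : ℕ) :
    ∀ k : ℕ, boxUniform P G {g : G | dist1 g < ε} K M k ⊆ plaqUniform P G (fun _ => 4 * ε) K M k
  | 0 => fun _ hU => plaqSmallOn_box_of_bonds hU
  | k + 1 => fun _ hω => ⟨plaqUniform_of_boxUniform ε K M k hω.1, plaqSmallOn_box_of_bonds hω.2⟩

variable {F : T4Family} {ε : ℝ} {m₁ K : ℕ}

/-- **FILE 10's READER `true` ⇒ THE PLAQUETTE READER `true`** (tolerances `ε` ↦ `4ε`): a column uniformly `ε`-small in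
its bond variables is `PlaqSmallOn` at `4ε` at every level. [folklore] -/
theorem plaqReader_eq_true_of_smallReader {ω : Tower (F.P K) G K}
    (h : smallReader F {g : G | dist1 g < ε} m₁ K ω = true) : plaqReader F (fun _ => 4 * ε) m₁ K ω = true :=
  (plaqReader_eq_true_iff ω).2 (plaqUniform_of_boxUniform ε K _ K ((smallReader_eq_true_iff ω).1 h))

/-- … so the plaquette reader's BAD pattern «every cube bad» lies inside the bond reader's. [folklore] -/
theorem setOf_plaqReader_false_subset (hm₁ : m₁ ≤ F.m) :
    {ω : Tower (F.P K) G K | ∀ c : BlockIdx 4 (cubeCount F m₁),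
        plaqReader F (fun _ => 4 * ε) m₁ K (towerTranslate K (cubeCorner (sitesPerDir_top_eq F hm₁ K) c) ω) = false} ⊆
      {ω | ∀ c : BlockIdx 4 (cubeCount F m₁),
        smallReader F {g : G | dist1 g < ε} m₁ K (towerTranslate K (cubeCorner (sitesPerDir_top_eq F hm₁ K) c) ω) =
          false} := by
  intro ω hω c
  rcases hb : smallReader F {g : G | dist1 g < ε} m₁ K (towerTranslate K (cubeCorner (sitesPerDir_top_eq F hm₁ K) c) ω)
    with _ | _
  · rfl
  · exact absurd (plaqReader_eq_true_of_smallReader hb) (by rw [hω c]; exact Bool.false_ne_true)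

variable [MeasurableSpace G] [RegularGaugeGroup G] [HaarData G] {D : FiniteEpsData F G} {g₀ : ℕ → ℝ}
  {hm₁ : m₁ ≤ F.m} {r : ℝ}

/-- **FILE 10's ONE INEQUALITY IMPLIES FILE 11's** (measurable averagings `D.AvgMeasurable`, so that the Gibbs tower
is a probability measure): the (U1)×(G2) inequality displayed by `readerCellSide_dist1` for the bond reader at `ε`
gives the plaquette reader's `ReaderCellSide` at the constant tolerance `4ε` with the SAME rate. [folklore] -/
theorem readerCellSide_plaqReader_of_bonds (hM : D.AvgMeasurable) (hr : 0 ≤ r)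
    (huniv : (gibbsTower D g₀ K).real
      {ω | ∀ c : BlockIdx 4 (cubeCount F m₁),
        smallReader F {g : G | dist1 g < ε} m₁ K (towerTranslate K (cubeCorner (sitesPerDir_top_eq F hm₁ K) c) ω) =
          false} ≤ r ^ (cubeCount F m₁ ^ 4)) :
    ReaderCellSide D g₀ hm₁ K ({false} : Finset Bool) (plaqReader F (fun _ => 4 * ε) m₁ K) r :=
  haveI := isProbabilityMeasure_gibbsTower D hM g₀ K
  readerCellSide_plaqReader hr
    ((measureReal_mono (setOf_plaqReader_false_subset hm₁) (measure_ne_top _ _)).trans huniv)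

end Junction

end

end Summit.QuantumFields.BalabanUV.T4Continuum.HistoryChessboardPlaquetteReaderBonds
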